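import Summits.AtomisticToContinuum.Crystallization.Theses.SumsetDoublingRigidity
import Summits.AtomisticToContinuum.Crystallization.Theorems.PalmUnimodularRigidityBenjaminiSchrammLimit

/-!
# Birth skeleton (BC3) for crux `SumsetDoublingRigidity.SmallDoublingCharged`
# (item stmt-AtomisticToContinuum-16933 · route `route-AtomisticToContinuum-SumsetDoublingRigidity` · rank 2)

CRUX = `SmallDoublingCharged`: every sequence of Lennard-Jones ground states `x^N ⊂ ℝ³` charges, with
positive density at every scale `(R, ε)` and frequently in `N` (the verbatim format of the shared
hinge 2911: two-way `ε`-matching of `R`-neighbourhoods with `x_i + A(X − q)`, `A` a linear isometry,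
`q ∈ X`), the windows of ONE set `X` that is `δ`-separated, `(9/10)δ`-covered (saturated) and has
FEW PAIR SUMS: `(X+X) ∩ B_R` finite and `#((X+X) ∩ B_R) ≤ θ·#(X ∩ B_R)` for some `θ < 2` and all
large `R`.

THE LINE (the route header's TWO-LAYER PLAN "SmallDoublingCharged ⇐ ExactSaturatedChargedSet →
ChargedSetsFewSums", typed at the level where it is plausible and attackable). Two corrections to the
naive finite-`N` typing are forced:
(1) "every charged saturated set has few sums" is FALSE if "charged" only means the crux's own clause
    (floating base points `q ∈ X`): a Frankenstein set (hcp on a half-space, a generic saturated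
    perturbation on the other half) is charged through base points deep in its hcp half and has
    `κ ≥ 2` (one twin plane already gives `κ ≥ 3`; one generic displaced atom adds `1`). The
    few-sums stub therefore assumes charging of the patches at ONE FIXED base point `q₀` at EVERY
    scale — which pins all of `X` — and the existence stub delivers exactly that.
(2) criticality is not enough (dhcp = ABAC is an exact force-balanced saturated set with `κ = 2`:
    A-sites are inversion centres, B/C-sites have a horizontal mirror and a 3-fold axis), so the
    few-sums stub must see MINIMALITY. It is stated at the LAW level — minimising point-stationary
    hard-core laws, the hypothesis block of `PalmUnimodularRigidity.PalmRigidity` (item 9224) verbatim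
    — where mean energy `= e*`, ergodic decomposition and mass transport are available, and it is
    reached through two PROVED tree theorems: the Benjamini–Schramm limit of ground states
    `Summit.AtomisticToContinuum.Crystallization.Theorems.benjaminiSchrammLimit_proof` (item 9230: a
    subsequence `φ`, a hard core `δ`, a point-stationary law `P` with `E_P[h] = lim E(φ j)/φ j` and
    the density-transfer clause) and `CrysEnergyLimit_holds` (item 0626, `E(N)/N → e*`, so `P` is
    minimising).

* `stub_minimisingLawsChargeSaturatedSet` — COHESION + EXACTNESS (law level, open-problem strength,
  strictly below periodicity and below FLC): every minimising point-stationary hard-core law `P`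
  charges, at every scale `(R, ε)` and at one base point `q₀ ∈ X`, the patches of ONE `δ'`-separated,
  `(9/10)δ'`-covered set `X` (ε-fattened patch events of positive `P`-mass). No doubling here.
* `stub_lawChargingTransfers` — DENSITY TRANSFER (size M; the statement is letter for letter the
  stub of the same name in `Cruxes/GroundStatesChargeFLCEquilibrium/Lines/birth.lean`, so ONE proof
  serves both lines): law-level charging at `q` + the density-transfer clause of the BS limit ⇒
  `≥ ρ·φ(j)` particles of `x^(φ j)` two-way `(R, ε)`-matched with `x_i + A(X − q)`, eventually in `j`.
* `stub_chargedSaturatedSetsFewSums` — THE ADDITIVE CONTENT (selection without identification):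
  a `δ'`-separated `(9/10)δ'`-covered set `X` whose patches at one base point `q₀` are charged at
  EVERY scale by a minimising point-stationary hard-core law has a locally finite sumset with
  `#((X+X) ∩ B_R) ≤ θ·#(X ∩ B_R)`, `θ < 2`, for all large `R`. Expected mechanism: such an `X` lies
  (patch by patch, `ε → 0` at fixed `R`, compactness of `O(3)`) in the local-topology support of a
  minimising ergodic law; minimality excludes a positive density of stacking faults / defects /
  non-quantised displacements, leaving a lattice (`κ = 1`) or a 2-lattice such as relaxed hcp
  (`X + X = L ∪ (L+t) ∪ (L+2t)`, `κ = 3/2`); fails iff Lennard-Jones minimising laws charge a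
  saturated exact structure with `κ ≥ 2` (dhcp/4H `2`, 6H `7/3`, generic Barlow words `→ 3`,
  quasicrystals `≥ 2`).

Consistency: `PalmRigidity` (9224, the open target of route PalmUnimodularRigidity: minimising laws
are a.s. rotated relaxed hcp) implies stubs 1 and 3 (take `X = A(hcpStacking a h)` with `(a, h, A)` in
the support of the parameter law; `κ(hcp) = 3/2`, cf. support item 16937 `HcpDoublingThreeHalves`);
neither stub identifies the charged structure, which is the point of this route.

`SmallDoublingCharged_of_stubs : stub₁ → stub₂ → stub₃ → (body of the crux)` is PROVED below and
`SmallDoublingCharged_of : SmallDoublingCharged` (BY NAME) applies it to the three stubs; the only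
sorries of the file are the three `stub_*` (the skeleton audit requires the by-name theorem to have no
unregistered hypotheses, hence the two-theorem layout).

Disproof used: none on file (`ledger crux ls stmt-AtomisticToContinuum-16933`: no workfiles, no
Disproof.lean, no Negative lemmas; the negatives index of the summit (20 entries, 2026-08-17) has no
law-level, charging or sumset statement).
-/

noncomputable section

open MeasureTheory Filter
open scoped ENNReal Topology
open Literature.MathematicalPhysics.StatisticalMechanics

namespace Summit.AtomisticToContinuum.Crystallization.Cruxes.SmallDoublingCharged.Birth

/-- Counting helper for the assembly: a pointwise implication of predicates on a finite type does
not decrease the cardinality of the subtype. [folklore] -/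
theorem natCard_subtype_mono {α : Type*} [Finite α] {p q : α → Prop} (h : ∀ a, p a → q a) :
    Nat.card {a // p a} ≤ Nat.card {a // q a} :=
  Nat.card_le_card_of_injective (Subtype.map id h) (Subtype.map_injective h Function.injective_id)

/-! ## Registered stubs (the only sorries of the file) -/

/-- **Stub 1 — cohesion + exactness: minimising laws charge ONE saturated exact set (law level).**
Every minimising point-stationary hard-core probability law `P` on rooted configurations of `ℝ³`
(`E_P[h] ≤ e* = ⨅ periodic e(Q)`; the hypothesis block of `PalmRigidity`, item 9224, verbatim)
charges, at every scale `(R, ε)`, the patches at one base point `q₀ ∈ X` of ONE set `X` that is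
`δ'`-separated and `(9/10)δ'`-covered: the event "after a linear isometry `A`, the atoms of `ν` in the
ball of radius `R` are two-way `ε`-matched with `A((X − q₀) ∩ B_R)`" has positive `P`-mass. Why
plausibly true: if minimising laws are carried by rotated relaxed close packings (hcp, fcc: covering /
separation `1/√2 < 9/10`), any configuration in the (compact) support of the parameter marginal
works, exactly as in `palmToHinge_proof`; the statement asks neither periodicity nor FLC nor few
sums — a saturated quasicrystalline support would still satisfy it. Why it might fail: foam
(cohesion unproved, BlancLewin2015 §2.2), a positive density of vacancies / interstitials in every
minimising law synchronised so that no exact saturated set is charged at all scales, or a charged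
structure with covering/separation ratio `> 9/10` (diamond-like). Size: open-problem
(crystallization strength, strictly below periodicity). -/
theorem stub_minimisingLawsChargeSaturatedSet :
    ∀ δ : ℝ, 0 < δ → ∀ P : Measure (Measure (EuclideanSpace ℝ (Fin 3))), IsProbabilityMeasure P →
      (∀ᵐ μ ∂P, (∃ S : Set (EuclideanSpace ℝ (Fin 3)), (0 : EuclideanSpace ℝ (Fin 3)) ∈ S ∧
        (∀ x ∈ S, ∀ y ∈ S, x ≠ y → δ ≤ dist x y) ∧
        μ = (Measure.count : Measure (EuclideanSpace ℝ (Fin 3))).restrict S)) →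
      (∀ g : Measure (EuclideanSpace ℝ (Fin 3)) → EuclideanSpace ℝ (Fin 3) → ENNReal,
        Measurable (Function.uncurry g) →
        ∫⁻ μ, ∫⁻ y, g μ y ∂μ ∂P = ∫⁻ μ, ∫⁻ y, g (Measure.map (fun z => z - y) μ) (-y) ∂μ ∂P) →
      (∫ μ, (∫ y, lennardJones ‖y‖ ∂μ) / 2 ∂P) ≤
        (⨅ Q : PeriodicConfiguration 3, Q.energyPerParticle lennardJones) →
      ∃ X : Set (EuclideanSpace ℝ (Fin 3)),
        (∃ δ' : ℝ, 0 < δ' ∧ (∀ a ∈ X, ∀ b ∈ X, a ≠ b → δ' ≤ dist a b) ∧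
          (∀ z : EuclideanSpace ℝ (Fin 3), ∃ a ∈ X, dist z a ≤ 9 / 10 * δ')) ∧
        ∃ q₀ ∈ X, ∀ R ε : ℝ, 0 < R → 0 < ε →
          P {ν : Measure (EuclideanSpace ℝ (Fin 3)) |
              ∃ A : EuclideanSpace ℝ (Fin 3) →ₗᵢ[ℝ] EuclideanSpace ℝ (Fin 3),
                (∀ s ∈ X, dist s q₀ ≤ R →
                  ∃ p : EuclideanSpace ℝ (Fin 3), ν {p} ≠ 0 ∧ dist p (A (s - q₀)) ≤ ε) ∧
                (∀ p : EuclideanSpace ℝ (Fin 3), ν {p} ≠ 0 → ‖p‖ ≤ R →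
                  ∃ s ∈ X, dist p (A (s - q₀)) ≤ ε)} ≠ 0 := by
  sorry

/-- **Stub 2 — density transfer (portmanteau ⇒ charging).** Let `x` be configurations, `φ` a
subsequence and `P` a probability law tied to `x ∘ φ` by the density-transfer clause of the
Benjamini–Schramm limit (item 9230, verbatim). If `P` charges at every scale `(R, ε)` the patch of
`X` at the base point `q` (law-level two-way matching event of positive mass), then for all
`R, ε > 0` there is `ρ > 0` such that, eventually in `j`, at least `ρ·φ(j)` particles `i` of
`x^(φ j)` have their `R`-neighbourhood two-way `ε`-matched with `x_i + A(X − q)` for some linear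
isometry `A` (the crux's clause at the fixed base point `q`). Proof idea: `T :=` the law-level event
with radius `R + 1` and tolerance `min ε 1 / 2`; `P T ≠ 0` gives `ρ := P(T)/2 < P(T)`; the transfer
clause with radius `R + 1`, tolerance `min ε 1 / 2` yields particles whose recentred configuration
is matched to some `ν ∈ T`, and two two-way matchings compose (triangle inequality; points within
`R` of the centre have partners of norm `≤ R + 1/2`), cf. `matched_hcp_of_matched_near`. The
statement is letter for letter `stub_lawChargingTransfers` of
`Cruxes/GroundStatesChargeFLCEquilibrium/Lines/birth.lean` (one proof serves both lines). Size: M. -/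
theorem stub_lawChargingTransfers :
    ∀ (x : (N : ℕ) → (Fin N → EuclideanSpace ℝ (Fin 3))) (φ : ℕ → ℕ)
      (P : Measure (Measure (EuclideanSpace ℝ (Fin 3)))), IsProbabilityMeasure P →
      (∀ T : Set (Measure (EuclideanSpace ℝ (Fin 3))), ∀ R ε : ℝ, 0 < ε → ∀ ρ : ℝ,
        ρ < (P T).toReal → ∀ᶠ j : ℕ in Filter.atTop, ρ * (φ j : ℝ) ≤
          (Nat.card {i : Fin (φ j) // ∃ ν ∈ T,
            ((∀ p : EuclideanSpace ℝ (Fin 3), ν {p} ≠ 0 → ‖p‖ ≤ R →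
                ∃ q ∈ (Set.range (fun k : Fin (φ j) => x (φ j) k - x (φ j) i)), dist q p ≤ ε) ∧
              (∀ q ∈ (Set.range (fun k : Fin (φ j) => x (φ j) k - x (φ j) i)), ‖q‖ ≤ R →
                ∃ p : EuclideanSpace ℝ (Fin 3), ν {p} ≠ 0 ∧ dist q p ≤ ε))} : ℝ)) →
      ∀ (Λ : Set (EuclideanSpace ℝ (Fin 3))) (q : EuclideanSpace ℝ (Fin 3)),
        (∀ R ε : ℝ, 0 < R → 0 < ε →
          P {ν : Measure (EuclideanSpace ℝ (Fin 3)) |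
              ∃ A : EuclideanSpace ℝ (Fin 3) →ₗᵢ[ℝ] EuclideanSpace ℝ (Fin 3),
                (∀ s ∈ Λ, dist s q ≤ R →
                  ∃ p : EuclideanSpace ℝ (Fin 3), ν {p} ≠ 0 ∧ dist p (A (s - q)) ≤ ε) ∧
                (∀ p : EuclideanSpace ℝ (Fin 3), ν {p} ≠ 0 → ‖p‖ ≤ R →
                  ∃ s ∈ Λ, dist p (A (s - q)) ≤ ε)} ≠ 0) →
        ∀ R ε : ℝ, 0 < R → 0 < ε → ∃ ρ : ℝ, 0 < ρ ∧ ∀ᶠ j : ℕ in Filter.atTop,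
          ρ * (φ j : ℝ) ≤ (Nat.card {i : Fin (φ j) //
            ∃ A : EuclideanSpace ℝ (Fin 3) →ₗᵢ[ℝ] EuclideanSpace ℝ (Fin 3),
              (∀ s ∈ Λ, dist s q ≤ R →
                ∃ k : Fin (φ j), dist (x (φ j) k) (x (φ j) i + A (s - q)) ≤ ε) ∧
              (∀ k : Fin (φ j), dist (x (φ j) k) (x (φ j) i) ≤ R →
                ∃ s ∈ Λ, dist (x (φ j) k) (x (φ j) i + A (s - q)) ≤ ε)} : ℝ) := by
  sorry

/-- **Stub 3 — the additive content: charged saturated exact sets have few pair sums (law level).**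
Let `P` be a minimising point-stationary hard-core probability law on rooted configurations of `ℝ³`
(hypothesis block of `PalmRigidity`, item 9224, verbatim), `X ⊂ ℝ³` `δ'`-separated and
`(9/10)δ'`-covered, and `q₀ ∈ X` a base point whose patches are charged by `P` at EVERY scale
`(R, ε)` (ε-fattened two-way matching events of positive `P`-mass — this pins every finite patch of
`X`, not just some of them). Then the sumset of `X` is locally finite and has density ratio below
Kneser's threshold: for some `θ < 2` and all large `R`, `(X+X) ∩ B_R` is finite and
`#((X+X) ∩ B_R) ≤ θ·#(X ∩ B_R)` (balls about the origin, the crux's clause for `X` verbatim).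
Why plausibly true: `ε → 0` at fixed `R` and compactness of `O(3)` put every patch of `X − q₀`
exactly (up to rotation) in the local-topology support of `P`, hence — mean energy `= e*`
(`unimodularEnergyLowerBound_proof`, 9229) and ergodic decomposition — of a minimising ergodic law;
minimality forbids a positive density of stacking faults, point defects and non-quantised
displacements, so `X` is an exact lattice (`κ = 1`) or 2-lattice such as relaxed hcp
(`X + X = L ∪ (L+t) ∪ (L+2t)`, `κ = 3/2 < 2`, any `c/a`, any strain; cf. item 16937). It is
SELECTION WITHOUT IDENTIFICATION: the conclusion never names the structure. Why it might fail: the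
Lennard-Jones stacking minimiser is a polytype with `κ ≥ 2` (4H = dhcp `2`, 6H `7/3`) or is
degenerate (then disordered stackings are minimising and charge dhcp patches), or minimising laws
charge quasicrystalline saturated sets (model sets: `κ = vol(W+W)/vol(W) ≥ 2`). NOT implied by
criticality alone (dhcp is force-balanced). Size: open-problem (stacking selection + no exotic
charged phase), strictly below `PalmRigidity`. -/
theorem stub_chargedSaturatedSetsFewSums :
    ∀ δ : ℝ, 0 < δ → ∀ P : Measure (Measure (EuclideanSpace ℝ (Fin 3))), IsProbabilityMeasure P →
      (∀ᵐ μ ∂P, (∃ S : Set (EuclideanSpace ℝ (Fin 3)), (0 : EuclideanSpace ℝ (Fin 3)) ∈ S ∧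
        (∀ x ∈ S, ∀ y ∈ S, x ≠ y → δ ≤ dist x y) ∧
        μ = (Measure.count : Measure (EuclideanSpace ℝ (Fin 3))).restrict S)) →
      (∀ g : Measure (EuclideanSpace ℝ (Fin 3)) → EuclideanSpace ℝ (Fin 3) → ENNReal,
        Measurable (Function.uncurry g) →
        ∫⁻ μ, ∫⁻ y, g μ y ∂μ ∂P = ∫⁻ μ, ∫⁻ y, g (Measure.map (fun z => z - y) μ) (-y) ∂μ ∂P) →
      (∫ μ, (∫ y, lennardJones ‖y‖ ∂μ) / 2 ∂P) ≤
        (⨅ Q : PeriodicConfiguration 3, Q.energyPerParticle lennardJones) →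
      ∀ X : Set (EuclideanSpace ℝ (Fin 3)),
        (∃ δ' : ℝ, 0 < δ' ∧ (∀ a ∈ X, ∀ b ∈ X, a ≠ b → δ' ≤ dist a b) ∧
          (∀ z : EuclideanSpace ℝ (Fin 3), ∃ a ∈ X, dist z a ≤ 9 / 10 * δ')) →
        ∀ q₀ ∈ X,
          (∀ R ε : ℝ, 0 < R → 0 < ε →
            P {ν : Measure (EuclideanSpace ℝ (Fin 3)) |
                ∃ A : EuclideanSpace ℝ (Fin 3) →ₗᵢ[ℝ] EuclideanSpace ℝ (Fin 3),
                  (∀ s ∈ X, dist s q₀ ≤ R →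
                    ∃ p : EuclideanSpace ℝ (Fin 3), ν {p} ≠ 0 ∧ dist p (A (s - q₀)) ≤ ε) ∧
                  (∀ p : EuclideanSpace ℝ (Fin 3), ν {p} ≠ 0 → ‖p‖ ≤ R →
                    ∃ s ∈ X, dist p (A (s - q₀)) ≤ ε)} ≠ 0) →
          ∃ θ : ℝ, θ < 2 ∧ ∃ R₀ : ℝ, ∀ R : ℝ, R₀ ≤ R →
            ({v : EuclideanSpace ℝ (Fin 3) | ‖v‖ ≤ R ∧ ∃ a ∈ X, ∃ b ∈ X, v = a + b} :
                Set (EuclideanSpace ℝ (Fin 3))).Finite ∧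
            (({v : EuclideanSpace ℝ (Fin 3) | ‖v‖ ≤ R ∧ ∃ a ∈ X, ∃ b ∈ X, v = a + b} :
                Set (EuclideanSpace ℝ (Fin 3))).ncard : ℝ) ≤
              θ * (({a : EuclideanSpace ℝ (Fin 3) | a ∈ X ∧ ‖a‖ ≤ R} :
                Set (EuclideanSpace ℝ (Fin 3))).ncard : ℝ) := by
  sorry

/-! ## The assembly (sorry-free): stub₁ → stub₂ → stub₃ → the crux -/

/-- **The crux from the three stub STATEMENTS** (implication form; the conclusion is the body of
`SumsetDoublingRigidity.SmallDoublingCharged` verbatim, so that the ONLY theorem of this file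
concluding the crux BY NAME is `SmallDoublingCharged_of` below, as the skeleton audit requires).
Given a ground-state sequence `x`, the proved Benjamini–Schramm limit (`benjaminiSchrammLimit_proof`)
gives `φ, δ, P` with the hard-core, point-stationarity, energy and density-transfer clauses;
`CrysEnergyLimit_holds` along `φ` and uniqueness of limits make `P` minimising; stub 1 gives the
saturated set `X` charged at the law level at `q₀ ∈ X`; stub 3, fed with the same law, set and base
point, gives the doubling clause of the crux for `X`; stub 2 transfers the charging to `x^(φ j)`
eventually in `j`, hence frequently in `N`, and the fixed base point `q₀` is weakened to `∃ q ∈ X`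
by monotonicity of the count. -/
theorem SmallDoublingCharged_of_stubs :
    (∀ δ : ℝ, 0 < δ → ∀ P : Measure (Measure (EuclideanSpace ℝ (Fin 3))), IsProbabilityMeasure P →
      (∀ᵐ μ ∂P, (∃ S : Set (EuclideanSpace ℝ (Fin 3)), (0 : EuclideanSpace ℝ (Fin 3)) ∈ S ∧
        (∀ x ∈ S, ∀ y ∈ S, x ≠ y → δ ≤ dist x y) ∧
        μ = (Measure.count : Measure (EuclideanSpace ℝ (Fin 3))).restrict S)) →
      (∀ g : Measure (EuclideanSpace ℝ (Fin 3)) → EuclideanSpace ℝ (Fin 3) → ENNReal,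
        Measurable (Function.uncurry g) →
        ∫⁻ μ, ∫⁻ y, g μ y ∂μ ∂P = ∫⁻ μ, ∫⁻ y, g (Measure.map (fun z => z - y) μ) (-y) ∂μ ∂P) →
      (∫ μ, (∫ y, lennardJones ‖y‖ ∂μ) / 2 ∂P) ≤
        (⨅ Q : PeriodicConfiguration 3, Q.energyPerParticle lennardJones) →
      ∃ X : Set (EuclideanSpace ℝ (Fin 3)),
        (∃ δ' : ℝ, 0 < δ' ∧ (∀ a ∈ X, ∀ b ∈ X, a ≠ b → δ' ≤ dist a b) ∧
          (∀ z : EuclideanSpace ℝ (Fin 3), ∃ a ∈ X, dist z a ≤ 9 / 10 * δ')) ∧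
        ∃ q₀ ∈ X, ∀ R ε : ℝ, 0 < R → 0 < ε →
          P {ν : Measure (EuclideanSpace ℝ (Fin 3)) |
              ∃ A : EuclideanSpace ℝ (Fin 3) →ₗᵢ[ℝ] EuclideanSpace ℝ (Fin 3),
                (∀ s ∈ X, dist s q₀ ≤ R →
                  ∃ p : EuclideanSpace ℝ (Fin 3), ν {p} ≠ 0 ∧ dist p (A (s - q₀)) ≤ ε) ∧
                (∀ p : EuclideanSpace ℝ (Fin 3), ν {p} ≠ 0 → ‖p‖ ≤ R →
                  ∃ s ∈ X, dist p (A (s - q₀)) ≤ ε)} ≠ 0) →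
    (∀ (x : (N : ℕ) → (Fin N → EuclideanSpace ℝ (Fin 3))) (φ : ℕ → ℕ)
      (P : Measure (Measure (EuclideanSpace ℝ (Fin 3)))), IsProbabilityMeasure P →
      (∀ T : Set (Measure (EuclideanSpace ℝ (Fin 3))), ∀ R ε : ℝ, 0 < ε → ∀ ρ : ℝ,
        ρ < (P T).toReal → ∀ᶠ j : ℕ in Filter.atTop, ρ * (φ j : ℝ) ≤
          (Nat.card {i : Fin (φ j) // ∃ ν ∈ T,
            ((∀ p : EuclideanSpace ℝ (Fin 3), ν {p} ≠ 0 → ‖p‖ ≤ R →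
                ∃ q ∈ (Set.range (fun k : Fin (φ j) => x (φ j) k - x (φ j) i)), dist q p ≤ ε) ∧
              (∀ q ∈ (Set.range (fun k : Fin (φ j) => x (φ j) k - x (φ j) i)), ‖q‖ ≤ R →
                ∃ p : EuclideanSpace ℝ (Fin 3), ν {p} ≠ 0 ∧ dist q p ≤ ε))} : ℝ)) →
      ∀ (Λ : Set (EuclideanSpace ℝ (Fin 3))) (q : EuclideanSpace ℝ (Fin 3)),
        (∀ R ε : ℝ, 0 < R → 0 < ε →
          P {ν : Measure (EuclideanSpace ℝ (Fin 3)) |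
              ∃ A : EuclideanSpace ℝ (Fin 3) →ₗᵢ[ℝ] EuclideanSpace ℝ (Fin 3),
                (∀ s ∈ Λ, dist s q ≤ R →
                  ∃ p : EuclideanSpace ℝ (Fin 3), ν {p} ≠ 0 ∧ dist p (A (s - q)) ≤ ε) ∧
                (∀ p : EuclideanSpace ℝ (Fin 3), ν {p} ≠ 0 → ‖p‖ ≤ R →
                  ∃ s ∈ Λ, dist p (A (s - q)) ≤ ε)} ≠ 0) →
        ∀ R ε : ℝ, 0 < R → 0 < ε → ∃ ρ : ℝ, 0 < ρ ∧ ∀ᶠ j : ℕ in Filter.atTop,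
          ρ * (φ j : ℝ) ≤ (Nat.card {i : Fin (φ j) //
            ∃ A : EuclideanSpace ℝ (Fin 3) →ₗᵢ[ℝ] EuclideanSpace ℝ (Fin 3),
              (∀ s ∈ Λ, dist s q ≤ R →
                ∃ k : Fin (φ j), dist (x (φ j) k) (x (φ j) i + A (s - q)) ≤ ε) ∧
              (∀ k : Fin (φ j), dist (x (φ j) k) (x (φ j) i) ≤ R →
                ∃ s ∈ Λ, dist (x (φ j) k) (x (φ j) i + A (s - q)) ≤ ε)} : ℝ)) →
    (∀ δ : ℝ, 0 < δ → ∀ P : Measure (Measure (EuclideanSpace ℝ (Fin 3))), IsProbabilityMeasure P →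
      (∀ᵐ μ ∂P, (∃ S : Set (EuclideanSpace ℝ (Fin 3)), (0 : EuclideanSpace ℝ (Fin 3)) ∈ S ∧
        (∀ x ∈ S, ∀ y ∈ S, x ≠ y → δ ≤ dist x y) ∧
        μ = (Measure.count : Measure (EuclideanSpace ℝ (Fin 3))).restrict S)) →
      (∀ g : Measure (EuclideanSpace ℝ (Fin 3)) → EuclideanSpace ℝ (Fin 3) → ENNReal,
        Measurable (Function.uncurry g) →
        ∫⁻ μ, ∫⁻ y, g μ y ∂μ ∂P = ∫⁻ μ, ∫⁻ y, g (Measure.map (fun z => z - y) μ) (-y) ∂μ ∂P) →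
      (∫ μ, (∫ y, lennardJones ‖y‖ ∂μ) / 2 ∂P) ≤
        (⨅ Q : PeriodicConfiguration 3, Q.energyPerParticle lennardJones) →
      ∀ X : Set (EuclideanSpace ℝ (Fin 3)),
        (∃ δ' : ℝ, 0 < δ' ∧ (∀ a ∈ X, ∀ b ∈ X, a ≠ b → δ' ≤ dist a b) ∧
          (∀ z : EuclideanSpace ℝ (Fin 3), ∃ a ∈ X, dist z a ≤ 9 / 10 * δ')) →
        ∀ q₀ ∈ X,
          (∀ R ε : ℝ, 0 < R → 0 < ε →
            P {ν : Measure (EuclideanSpace ℝ (Fin 3)) |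
                ∃ A : EuclideanSpace ℝ (Fin 3) →ₗᵢ[ℝ] EuclideanSpace ℝ (Fin 3),
                  (∀ s ∈ X, dist s q₀ ≤ R →
                    ∃ p : EuclideanSpace ℝ (Fin 3), ν {p} ≠ 0 ∧ dist p (A (s - q₀)) ≤ ε) ∧
                  (∀ p : EuclideanSpace ℝ (Fin 3), ν {p} ≠ 0 → ‖p‖ ≤ R →
                    ∃ s ∈ X, dist p (A (s - q₀)) ≤ ε)} ≠ 0) →
          ∃ θ : ℝ, θ < 2 ∧ ∃ R₀ : ℝ, ∀ R : ℝ, R₀ ≤ R →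
            ({v : EuclideanSpace ℝ (Fin 3) | ‖v‖ ≤ R ∧ ∃ a ∈ X, ∃ b ∈ X, v = a + b} :
                Set (EuclideanSpace ℝ (Fin 3))).Finite ∧
            (({v : EuclideanSpace ℝ (Fin 3) | ‖v‖ ≤ R ∧ ∃ a ∈ X, ∃ b ∈ X, v = a + b} :
                Set (EuclideanSpace ℝ (Fin 3))).ncard : ℝ) ≤
              θ * (({a : EuclideanSpace ℝ (Fin 3) | a ∈ X ∧ ‖a‖ ≤ R} :
                Set (EuclideanSpace ℝ (Fin 3))).ncard : ℝ)) →
    -- the crux `SumsetDoublingRigidity.SmallDoublingCharged`, body verbatim (definitionally the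
    -- crux; the by-name conclusion is `SmallDoublingCharged_of` below)
    ∀ x : (N : ℕ) → (Fin N → EuclideanSpace ℝ (Fin 3)), (∀ N, IsGroundState lennardJones (x N)) →
      ∃ X : Set (EuclideanSpace ℝ (Fin 3)),
        (∃ δ : ℝ, 0 < δ ∧ (∀ a ∈ X, ∀ b ∈ X, a ≠ b → δ ≤ dist a b) ∧
          (∀ z : EuclideanSpace ℝ (Fin 3), ∃ a ∈ X, dist z a ≤ 9 / 10 * δ)) ∧
        (∃ θ : ℝ, θ < 2 ∧ ∃ R₀ : ℝ, ∀ R : ℝ, R₀ ≤ R →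
          ({v : EuclideanSpace ℝ (Fin 3) | ‖v‖ ≤ R ∧ ∃ a ∈ X, ∃ b ∈ X, v = a + b} :
              Set (EuclideanSpace ℝ (Fin 3))).Finite ∧
          (({v : EuclideanSpace ℝ (Fin 3) | ‖v‖ ≤ R ∧ ∃ a ∈ X, ∃ b ∈ X, v = a + b} :
              Set (EuclideanSpace ℝ (Fin 3))).ncard : ℝ) ≤
            θ * (({a : EuclideanSpace ℝ (Fin 3) | a ∈ X ∧ ‖a‖ ≤ R} :
              Set (EuclideanSpace ℝ (Fin 3))).ncard : ℝ)) ∧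
        ∀ R ε : ℝ, 0 < R → 0 < ε → ∃ ρ : ℝ, 0 < ρ ∧ ∃ᶠ N : ℕ in Filter.atTop,
          ρ * (N : ℝ) ≤ (Nat.card {i : Fin N //
            ∃ A : EuclideanSpace ℝ (Fin 3) →ₗᵢ[ℝ] EuclideanSpace ℝ (Fin 3), ∃ q ∈ X,
              (∀ s ∈ X, dist s q ≤ R → ∃ j : Fin N, dist (x N j) (x N i + A (s - q)) ≤ ε) ∧
              (∀ j : Fin N, dist (x N j) (x N i) ≤ R →
                ∃ s ∈ X, dist (x N j) (x N i + A (s - q)) ≤ ε)} : ℝ) := by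
  intro hSat hTransfer hFew x hx
  -- the proved Benjamini–Schramm limit of the ground states (item 9230)
  obtain ⟨φ, hφ, δ, hδ, P, hP, hcore, hstat, hE, htr⟩ :=
    Summit.AtomisticToContinuum.Crystallization.Theorems.benjaminiSchrammLimit_proof x hx
  -- the limit law is minimising: `E_P[h] = lim E(φ j)/φ j = e*` (item 0626, proved)
  have hLim : Filter.Tendsto (fun N : ℕ => groundStateEnergy lennardJones 3 N / N) Filter.atTop
      (nhds (⨅ Q : PeriodicConfiguration 3, Q.energyPerParticle lennardJones)) :=
    Summit.AtomisticToContinuum.Crystallization.Theses.PalmUnimodularRigidity.CrysEnergyLimit_holds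
  have hlim' : Filter.Tendsto (fun j : ℕ => groundStateEnergy lennardJones 3 (φ j) / (φ j : ℝ))
      Filter.atTop (nhds (⨅ Q : PeriodicConfiguration 3, Q.energyPerParticle lennardJones)) :=
    hLim.comp hφ.tendsto_atTop
  have hEq := tendsto_nhds_unique hE hlim'
  -- stub 1: one saturated exact set charged at the law level at a base point `q₀`
  obtain ⟨X, hsat, q₀, hq₀, hch⟩ := hSat δ hδ P hP hcore hstat hEq.le
  -- stub 3: the doubling clause of the crux for this `X`
  have hdoub := hFew δ hδ P hP hcore hstat hEq.le X hsat q₀ hq₀ hch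
  -- stub 2: transfer to the configurations `x (φ j)`, eventually in `j`
  have hfin := hTransfer x φ P hP htr X q₀ hch
  refine ⟨X, hsat, hdoub, ?_⟩
  -- the charging clause of the crux, base point `q₀`, frequently in `N`
  intro R ε hR hε
  obtain ⟨ρ, hρ, hev⟩ := hfin R ε hR hε
  refine ⟨ρ, hρ, ?_⟩
  -- monotonicity of the count: matched at `q₀` ⇒ matched at some `q ∈ X`
  have himp : ∀ (N : ℕ) (i : Fin N),
      (∃ A : EuclideanSpace ℝ (Fin 3) →ₗᵢ[ℝ] EuclideanSpace ℝ (Fin 3),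
        (∀ s ∈ X, dist s q₀ ≤ R → ∃ k : Fin N, dist (x N k) (x N i + A (s - q₀)) ≤ ε) ∧
        (∀ k : Fin N, dist (x N k) (x N i) ≤ R →
          ∃ s ∈ X, dist (x N k) (x N i + A (s - q₀)) ≤ ε)) →
      ∃ A : EuclideanSpace ℝ (Fin 3) →ₗᵢ[ℝ] EuclideanSpace ℝ (Fin 3), ∃ q ∈ X,
        (∀ s ∈ X, dist s q ≤ R → ∃ k : Fin N, dist (x N k) (x N i + A (s - q)) ≤ ε) ∧
        (∀ k : Fin N, dist (x N k) (x N i) ≤ R →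
          ∃ s ∈ X, dist (x N k) (x N i + A (s - q)) ≤ ε) :=
    fun N i hi => hi.imp fun A hA => ⟨q₀, hq₀, hA⟩
  have hev' : ∀ᶠ j : ℕ in Filter.atTop, ρ * ((φ j : ℕ) : ℝ) ≤
      (Nat.card {i : Fin (φ j) //
        ∃ A : EuclideanSpace ℝ (Fin 3) →ₗᵢ[ℝ] EuclideanSpace ℝ (Fin 3), ∃ q ∈ X,
          (∀ s ∈ X, dist s q ≤ R →
            ∃ k : Fin (φ j), dist (x (φ j) k) (x (φ j) i + A (s - q)) ≤ ε) ∧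
          (∀ k : Fin (φ j), dist (x (φ j) k) (x (φ j) i) ≤ R →
            ∃ s ∈ X, dist (x (φ j) k) (x (φ j) i + A (s - q)) ≤ ε)} : ℝ) := by
    filter_upwards [hev] with j hj
    refine hj.trans ?_
    exact_mod_cast natCard_subtype_mono (himp (φ j))
  exact hφ.tendsto_atTop.frequently
    (p := fun N : ℕ => ρ * (N : ℝ) ≤ (Nat.card {i : Fin N //
        ∃ A : EuclideanSpace ℝ (Fin 3) →ₗᵢ[ℝ] EuclideanSpace ℝ (Fin 3), ∃ q ∈ X,
          (∀ s ∈ X, dist s q ≤ R → ∃ k : Fin N, dist (x N k) (x N i + A (s - q)) ≤ ε) ∧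
          (∀ k : Fin N, dist (x N k) (x N i) ≤ R →
            ∃ s ∈ X, dist (x N k) (x N i + A (s - q)) ≤ ε)} : ℝ))
    hev'.frequently

/-- **The skeleton concludes the crux BY NAME**: the three registered stubs fed into
`SmallDoublingCharged_of_stubs`; no sorry of its own (the file's sorries are exactly the three
`stub_*`). -/
theorem SmallDoublingCharged_of :
    Summit.AtomisticToContinuum.Crystallization.Theses.SumsetDoublingRigidity.SmallDoublingCharged :=
  SmallDoublingCharged_of_stubs stub_minimisingLawsChargeSaturatedSet stub_lawChargingTransfers
    stub_chargedSaturatedSetsFewSums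

end Summit.AtomisticToContinuum.Crystallization.Cruxes.SmallDoublingCharged.Birth

end
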